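import Mathlib
import Summits.NavierStokesRegularity.NavierStokesRegularity.Theorems.PowerGaugeEulerLiouville.Negative.BudgetedClassicalAncientFlow
import Summits.NavierStokesRegularity.NavierStokesRegularity.Theorems.EulerZoomLiouvillePowerGaugeEulerLiouvilleFiniteEnergyStrata

/-!
# Crux `EulerZoomLiouville.PowerGaugeEulerLiouville` (stmt-NavierStokesRegularity-19832) — negative edge, WEAK form:
# a BUDGETED SUITABLE WEAK EULER PAIR (Euler-INEQUALITY members included) refutes the crux for every `ρ ∈ (0, ½]`

Negative-lane record (prover hand leafhand-ns-eulerzoomliouville-8 g0; `--supports` stmt-19832).  The class of the crux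
is Caffarelli–Kohn–Nirenberg's SUITABLE WEAK pairs at `ν = 0`: the local energy INEQUALITY, not the identity, is
required — so Scheffer-type «Euler-inequality» members (energy sinks allowed) are in the class, as the item's
`why_might_fail` notes.  This file records the budget test in that native currency: a suitable weak Euler pair `(u,p)`
on the slab with a weak spatial gradient `H`, THREE FINITE GLOBAL BUDGETS `∫|u(t)|² ≤ M` (`t < 0`),
`∫∫|H|²_F ≤ M`, `∫∫|p|^{3/2} ≤ M`, and pointwise bounds on `u`, `|H|²_F`, `p` on the unit cylinder below the vertex,
satisfies Seregin's power-gauged bound for every `ρ ∈ [0, ½]` (`powerGauge_le_of_budgets` of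
`…Negative.BudgetedClassicalAncientFlow`); if it is not a.e. zero it refutes the crux
(`powerGaugeEulerLiouville_false_of_budgetedSuitablePair`); none is known (convex integration stays below `H^{1/2}`).
The TIME-LOCALISED door is recorded CLOSED (`ae_eq_zero_of_budgetedSuitablePair_fromRest`, every member, no `ρ`):
a budgeted suitable pair that is at rest before some time is a.e. zero — by the tree's finite-energy stratum
`PowerGaugeEulerLiouville.powerGaugeEulerLiouville_finiteEnergy_fromRest` (the local energy INEQUALITY forbids
«spontaneous generation with energy sinks») applied at `ρ = 0` to the gauge bound `powerGauge_le_of_budgets`.  So a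
refuting budgeted member carries its energy from `t = −∞`.

WHAT THIS IS NOT: not a refutation of the crux, of a stub, or of the route; not a claim about Navier–Stokes; no such
pair is constructed here. [folklore] -/

noncomputable section
set_option linter.dupNamespace false
namespace Summit.NavierStokesRegularity.NavierStokesRegularity.Theorems.PowerGaugeEulerLiouville.Negative

open MeasureTheory Set Function Filter Topology Metric Literature.Analysis Literature.Analysis.FluidPDE
open scoped NNReal ENNReal

/-- **NEGATIVE EDGE, WEAK FORM (¬ crux modulo a budgeted suitable weak Euler pair).**  A suitable weak (`ν = 0`,
`f = 0`) pair `(u,p)` on `(−∞,0) × ℝ³` with weak spatial gradient `H`, finite global energy / `|H|²_F` / `|p|^{3/2}`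
budgets, pointwise bounds on the unit cylinder below the vertex, and `u` not a.e. zero, refutes
`PowerGaugeEulerLiouville` (stmt-19832) — at every `ρ ∈ (0,½]`, instantiated at `ρ = ½`. [folklore] -/
theorem powerGaugeEulerLiouville_false_of_budgetedSuitablePair
    {u : ℝ → EuclideanSpace ℝ (Fin 3) → EuclideanSpace ℝ (Fin 3)} {p : ℝ → EuclideanSpace ℝ (Fin 3) → ℝ}
    {H : ℝ → EuclideanSpace ℝ (Fin 3) → EuclideanSpace ℝ (Fin 3) →L[ℝ] EuclideanSpace ℝ (Fin 3)} {M : ℝ≥0} {K : ℝ}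
    (hsw : IsSuitableWeakSolutionOn (slab (EuclideanSpace ℝ (Fin 3)) (Iio 0) isOpen_Iio) 0 0 u p)
    (hH : HasWeakSpatialGradientOn (slab (EuclideanSpace ℝ (Fin 3)) (Iio 0) isOpen_Iio) u H)
    (hA : ∀ t : ℝ, t < 0 → ∫⁻ x, ‖u t x‖ₑ ^ 2 ≤ (M : ℝ≥0∞))
    (hE : ∫⁻ z in Iio (0 : ℝ) ×ˢ (univ : Set (EuclideanSpace ℝ (Fin 3))),
      ENNReal.ofReal (frobeniusNormSq (H z.1 z.2)) ≤ (M : ℝ≥0∞))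
    (hD : ∫⁻ z in Iio (0 : ℝ) ×ˢ (univ : Set (EuclideanSpace ℝ (Fin 3))), ‖p z.1 z.2‖ₑ ^ (3 / 2 : ℝ) ≤ (M : ℝ≥0∞))
    (hKu : ∀ t ∈ Ioo (-1 : ℝ) 0, ∀ x ∈ ball (0 : EuclideanSpace ℝ (Fin 3)) 1, ‖u t x‖ ≤ K)
    (hKH : ∀ t ∈ Ioo (-1 : ℝ) 0, ∀ x ∈ ball (0 : EuclideanSpace ℝ (Fin 3)) 1, frobeniusNormSq (H t x) ≤ K)
    (hKp : ∀ t ∈ Ioo (-1 : ℝ) 0, ∀ x ∈ ball (0 : EuclideanSpace ℝ (Fin 3)) 1, ‖p t x‖ ≤ K)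
    (hne : ¬ (uncurry u =ᵐ[volume.restrict (Iio (0 : ℝ) ×ˢ (univ : Set (EuclideanSpace ℝ (Fin 3))))] 0)) :
    ¬ Summit.NavierStokesRegularity.NavierStokesRegularity.Theses.EulerZoomLiouville.PowerGaugeEulerLiouville := by
  intro hcrux
  obtain ⟨c, hc⟩ := powerGauge_le_of_budgets (ρ := 1 / 2) (by norm_num) le_rfl hA hE hD hKu hKH hKp
  exact hne (hcrux (1 / 2) (by norm_num) u p H c hsw hH hc)

/-- **The time-localised door is CLOSED («no spontaneous generation», every member, `ρ`-free).**  A suitable weak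
(`ν = 0`, `f = 0`) pair on the slab with weak gradient `H`, finite global energy / `|H|²_F` / `|p|^{3/2}` budgets,
pointwise bounds below the vertex, which is AT REST before some time (`u(t,·) = 0` for `t < −T`), is a.e. zero:
the budgets give Seregin's gauge bound at `ρ = 0` (`powerGauge_le_of_budgets`) and the tree's finite-energy stratum
`powerGaugeEulerLiouville_finiteEnergy_fromRest` (global energy inequality from the LOCAL one) kills it. [folklore] -/
theorem ae_eq_zero_of_budgetedSuitablePair_fromRest
    {u : ℝ → EuclideanSpace ℝ (Fin 3) → EuclideanSpace ℝ (Fin 3)} {p : ℝ → EuclideanSpace ℝ (Fin 3) → ℝ}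
    {H : ℝ → EuclideanSpace ℝ (Fin 3) → EuclideanSpace ℝ (Fin 3) →L[ℝ] EuclideanSpace ℝ (Fin 3)} {M : ℝ≥0} {K T : ℝ}
    (hsw : IsSuitableWeakSolutionOn (slab (EuclideanSpace ℝ (Fin 3)) (Iio 0) isOpen_Iio) 0 0 u p)
    (hH : HasWeakSpatialGradientOn (slab (EuclideanSpace ℝ (Fin 3)) (Iio 0) isOpen_Iio) u H)
    (hA : ∀ t : ℝ, t < 0 → ∫⁻ x, ‖u t x‖ₑ ^ 2 ≤ (M : ℝ≥0∞))
    (hE : ∫⁻ z in Iio (0 : ℝ) ×ˢ (univ : Set (EuclideanSpace ℝ (Fin 3))),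
      ENNReal.ofReal (frobeniusNormSq (H z.1 z.2)) ≤ (M : ℝ≥0∞))
    (hD : ∫⁻ z in Iio (0 : ℝ) ×ˢ (univ : Set (EuclideanSpace ℝ (Fin 3))), ‖p z.1 z.2‖ₑ ^ (3 / 2 : ℝ) ≤ (M : ℝ≥0∞))
    (hKu : ∀ t ∈ Ioo (-1 : ℝ) 0, ∀ x ∈ ball (0 : EuclideanSpace ℝ (Fin 3)) 1, ‖u t x‖ ≤ K)
    (hKH : ∀ t ∈ Ioo (-1 : ℝ) 0, ∀ x ∈ ball (0 : EuclideanSpace ℝ (Fin 3)) 1, frobeniusNormSq (H t x) ≤ K)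
    (hKp : ∀ t ∈ Ioo (-1 : ℝ) 0, ∀ x ∈ ball (0 : EuclideanSpace ℝ (Fin 3)) 1, ‖p t x‖ ≤ K)
    (hrest : ∀ t : ℝ, t < -T → ∀ x : EuclideanSpace ℝ (Fin 3), u t x = 0) :
    uncurry u =ᵐ[volume.restrict (Iio (0 : ℝ) ×ˢ (univ : Set (EuclideanSpace ℝ (Fin 3))))] 0 := by
  obtain ⟨c, hc⟩ := powerGauge_le_of_budgets (ρ := 0) le_rfl (by norm_num) hA hE hD hKu hKH hKp
  have hc' : ∀ a : ℝ, 0 < a →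
      ENNReal.ofReal (a ^ (2 * (0 : ℝ))) * cknA a (0 : ℝ × EuclideanSpace ℝ (Fin 3)) u +
          ENNReal.ofReal (a ^ (0 : ℝ)) * cknE a (0 : ℝ × EuclideanSpace ℝ (Fin 3)) H +
        ENNReal.ofReal (a ^ (2 * (0 : ℝ))) * cknD a (0 : ℝ × EuclideanSpace ℝ (Fin 3)) p ≤ (c : ℝ≥0∞) := hc
  exact PowerGaugeEulerLiouville.powerGaugeEulerLiouville_finiteEnergy_fromRest 0 le_rfl u p H c hsw hH hc'
    ⟨M, hA⟩ ⟨T, hrest⟩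

end Summit.NavierStokesRegularity.NavierStokesRegularity.Theorems.PowerGaugeEulerLiouville.Negative
end
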